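import Summits.Ventures.LatticeQCDFlow.Exactness.IMHCommonRandomNumbersContraction
import Summits.Ventures.LatticeQCDFlow.Scoring.ChainMeanSquareError
import HarnessLib

/-!
# Two coupled flow-MCMC runs that have met never split on the pair path law: after `n` shared updates they coincide FOREVER
# except with probability `(1 − A)ⁿ·P(X_0 ≠ X′_0)`, and almost surely they coincide forever from some time on

HONEST FRAMING: exact (Metropolis-corrected) sampling algorithms for lattice gauge theory;
figures of merit are autocorrelation/cost numbers at stated couplings and volumes; no
continuum-physics claim.

Venture `LatticeQCDFlow` (cell pub-lqcd), topic `Exactness`; FANOUT row 30 (lean-1, GEN-38).  NEW WORK of the cell,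
general state space with `MeasurableEq Ω`; sequel to `Exactness/IMHCommonRandomNumbersContraction` (GEN-37: the CRN pair
kernel `K̂` of `K = indepMH q w` — two runs fed the SAME proposals and uniforms — never splits a merged pair,
`K̂((x,x), Δᶜ) = 0`, and `P(X_n ≠ X′_n) ≤ rⁿ·P(X_0 ≠ X′_0)` at each single time, `r = 1 − A`, `A = 1/w(x₀)` for `w` normalised
and maximal at `x₀`).  GEN-37 recorded «NOT CLAIMED: the path-space form "coincide forever after `b` with probability
`≥ 1 − r^b·P(X_0 ≠ X′_0)" (needs the decomposition of a coupling along the diagonal; not typed)».  It is typed here WITHOUT that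
decomposition, on the pair PATH law `P̂_{μ̂₀}` (Mathlib's `Kernel.trajMeasure` of `K̂` from the initial coupling `μ̂₀`): the
no-splitting identity holds almost surely along the path, so «disagree at some `m ≥ n`» is «disagree at `n`» up to a null set.

* §1 **`crn_chain_diag_succ_offDiagonal_eq_zero`** — `P̂(Z_n ∈ Δ, Z_{n+1} ∉ Δ) = 0` for every `n` (the two-time marginal of the
  path law, `Scoring/ChainMeanSquareError.chain_twoTime_initial`, against `K̂((x,x), Δᶜ) = 0`); hence
  **`crn_chain_ae_noSplit`** — almost surely `Z_n ∈ Δ ⇒ Z_{n+1} ∈ Δ` for all `n` — and **`crn_chain_ae_merged_stay`** — almost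
  surely `Z_n ∈ Δ ⇒ Z_m ∈ Δ` for all `n ≤ m`: ON ALMOST EVERY PAIR PATH, RUNS THAT HAVE MET STAY TOGETHER.
* §2 **`crn_chain_offDiagonal_real_eq`** — `P̂(Z_n ∉ Δ) = (μ̂₀K̂ⁿ)(Δᶜ)` [bookkeeping]; **`crn_chain_notMerged_after_le`** — THE
  PATH-SPACE CONTRACTION WITH THE INITIAL-DISAGREEMENT FACTOR: `P̂(∃ m ≥ n, X_m ≠ X′_m) ≤ rⁿ·P(X_0 ≠ X′_0)` from every initial
  coupling; **`crn_chain_merged_forever_ge`** — `P̂(∀ m ≥ n, X_m = X′_m) ≥ 1 − rⁿ·P(X_0 ≠ X′_0)`: after `n` shared updates the two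
  runs COINCIDE FOREVER except with probability `rⁿ·P(X_0 ≠ X′_0)` (GEN-36 `IMHCommonRandomNumbersPath`: the factor-free
  `r^b` through the exact split; here the factor `P(X_0 ≠ X′_0)` of GEN-37's one-time contraction is carried to path space).
* §3 **`crn_chain_ae_eventually_merged`** — ALMOST SURELY THE TWO RUNS COINCIDE FOREVER FROM SOME TIME ON:
  `P̂(∃ n, ∀ m ≥ n, X_m = X′_m) = 1` from every initial coupling — the meeting time is almost surely finite (`rⁿ → 0` since
  `A > 0` for a normalised weight with a mode).
Reading (gauge files): two exact gauge samplers driven by one stream of random numbers that already agree with probability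
`1 − p` are ONE RUN FOREVER after `n` more updates except with probability `(1 − A)ⁿ·p`, and with probability one they become
one run forever at some finite time.  Sequel (this generation): the law of the disagreement time (geometric tail, second
moment) in `Exactness/IMHCommonRandomNumbersMeetingTimeLaw`.
NOT CLAIMED: equality (GEN-36 `IMHCommonRandomNumbersSharp`: from (cold, off-mode) with an atom-free proposal); observables of
the whole future after `n` (they follow set by set; not typed here); anything for two different proposals or any value of `A`.
No `sorry`, no new definitions, nothing cited as a fact.
-/

noncomputable section

namespace Summit.Ventures.LatticeQCDFlow.Exactness

open MeasureTheory ProbabilityTheory Function Finset Filter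
open scoped ENNReal unitInterval Topology
open Summit.Ventures.LatticeQCDFlow.Scoring

variable {Ω : Type*} [MeasurableSpace Ω] {q : Measure Ω} [IsProbabilityMeasure q] {w : Ω → ℝ}

/-! ## §1 Merged runs never split, almost surely on the pair path law -/

/-- **`P̂(Z_n ∈ Δ, Z_{n+1} ∉ Δ) = 0`** on the pair path law from every initial coupling: the two-time marginal of the path law
against `K̂((x,x), Δᶜ) = 0`. [ours] -/
theorem crn_chain_diag_succ_offDiagonal_eq_zero [MeasurableEq Ω] (hw : Measurable w) (hw0 : ∀ y, 0 < w y)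
    (Khat : Kernel (Ω × Ω) (Ω × Ω)) [IsMarkovKernel Khat]
    (hK : ∀ z : Ω × Ω, Khat z = (q.prod (volume : Measure unitInterval)).map (fun p : Ω × unitInterval =>
      ((if (p.2 : ℝ) * w z.1 ≤ w p.1 then p.1 else z.1), (if (p.2 : ℝ) * w z.2 ≤ w p.1 then p.1 else z.2))))
    (μ₀ : Measure (Ω × Ω)) [IsProbabilityMeasure μ₀] (n : ℕ) :
    (Kernel.trajMeasure (X := fun _ : ℕ => Ω × Ω) μ₀
        (fun n : ℕ => Khat.comap (fun h : (i : ↥(Finset.Iic n)) → Ω × Ω => h ⟨n, Finset.mem_Iic.2 le_rfl⟩)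
          (measurable_pi_apply _)))
      {z | z n ∈ Set.diagonal Ω ∧ z (n + 1) ∉ Set.diagonal Ω} = 0 := by
  set P := Kernel.trajMeasure (X := fun _ : ℕ => Ω × Ω) μ₀
      (fun n : ℕ => Khat.comap (fun h : (i : ↥(Finset.Iic n)) → Ω × Ω => h ⟨n, Finset.mem_Iic.2 le_rfl⟩)
        (measurable_pi_apply _)) with hP
  have hD : MeasurableSet (Set.diagonal Ω) := measurableSet_diagonal
  have hIm : Measurable ((Set.diagonal Ω).indicator (1 : Ω × Ω → ℝ)) := measurable_one.indicator hD
  have hIcm : Measurable ((Set.diagonal Ω)ᶜ.indicator (1 : Ω × Ω → ℝ)) := measurable_one.indicator hD.compl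
  have hIb : ∀ (S : Set (Ω × Ω)) (p : Ω × Ω), |S.indicator (1 : Ω × Ω → ℝ) p| ≤ 1 := by
    intro S p
    by_cases hp : p ∈ S
    · rw [Set.indicator_of_mem hp, Pi.one_apply, abs_one]
    · rw [Set.indicator_of_notMem hp, abs_zero]; exact zero_le_one
  -- the set as a product of one-time indicators
  have hS : MeasurableSet {z : ℕ → Ω × Ω | z n ∈ Set.diagonal Ω ∧ z (n + 1) ∉ Set.diagonal Ω} :=
    (hD.preimage (measurable_pi_apply n)).inter (hD.compl.preimage (measurable_pi_apply (n + 1)))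
  have hind : ∀ z : ℕ → Ω × Ω, ({z : ℕ → Ω × Ω | z n ∈ Set.diagonal Ω ∧ z (n + 1) ∉ Set.diagonal Ω}).indicator
      (1 : (ℕ → Ω × Ω) → ℝ) z =
      (Set.diagonal Ω).indicator (1 : Ω × Ω → ℝ) (z n) * (Set.diagonal Ω)ᶜ.indicator (1 : Ω × Ω → ℝ) (z (n + 1)) := by
    intro z
    by_cases h1 : z n ∈ Set.diagonal Ω
    · by_cases h2 : z (n + 1) ∈ Set.diagonal Ω
      · have hz : z ∉ {z : ℕ → Ω × Ω | z n ∈ Set.diagonal Ω ∧ z (n + 1) ∉ Set.diagonal Ω} := fun h => h.2 h2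
        have h2' : z (n + 1) ∉ (Set.diagonal Ω)ᶜ := fun h => h h2
        rw [Set.indicator_of_notMem hz, Set.indicator_of_mem h1, Set.indicator_of_notMem h2', mul_zero]
      · have hz : z ∈ {z : ℕ → Ω × Ω | z n ∈ Set.diagonal Ω ∧ z (n + 1) ∉ Set.diagonal Ω} := ⟨h1, h2⟩
        have h2' : z (n + 1) ∈ (Set.diagonal Ω)ᶜ := h2
        rw [Set.indicator_of_mem hz, Set.indicator_of_mem h1, Set.indicator_of_mem h2', Pi.one_apply, Pi.one_apply,
          Pi.one_apply, mul_one]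
    · have hz : z ∉ {z : ℕ → Ω × Ω | z n ∈ Set.diagonal Ω ∧ z (n + 1) ∉ Set.diagonal Ω} := fun h => h1 h.1
      rw [Set.indicator_of_notMem hz, Set.indicator_of_notMem h1, zero_mul]
  -- the two-time marginal: `E[1_Δ(Z_n)·1_{Δᶜ}(Z_{n+1})] = ∫ (kop K̂)^[n] (1_Δ · kop K̂ 1_{Δᶜ}) dμ̂₀`, and the inner function vanishes
  have h2 := chain_twoTime_initial Khat μ₀ n 1 (f := (Set.diagonal Ω)ᶜ.indicator (1 : Ω × Ω → ℝ)) hIcm (hIb _)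
    (g := (Set.diagonal Ω).indicator (1 : Ω × Ω → ℝ)) hIm (hIb _)
  have hzero : (fun u : Ω × Ω => (Set.diagonal Ω).indicator (1 : Ω × Ω → ℝ) u *
      (kop Khat)^[1] ((Set.diagonal Ω)ᶜ.indicator (1 : Ω × Ω → ℝ)) u) = fun _ => (0 : ℝ) := by
    funext u
    rw [Function.iterate_one]
    by_cases hu : u ∈ Set.diagonal Ω
    · obtain ⟨a, b⟩ := u
      have hab : a = b := hu
      subst hab
      have hk : kop Khat ((Set.diagonal Ω)ᶜ.indicator (1 : Ω × Ω → ℝ)) (a, a) = 0 := by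
        show ∫ y, (Set.diagonal Ω)ᶜ.indicator (1 : Ω × Ω → ℝ) y ∂(Khat (a, a)) = 0
        rw [integral_indicator_one hD.compl, measureReal_def, crnPair_diag_offDiagonal hw hw0 Khat hK a,
          ENNReal.toReal_zero]
      rw [hk, mul_zero]
    · rw [Set.indicator_of_notMem hu, zero_mul]
  rw [hzero, Function.iterate_fixed (kop_const (κ := Khat) 0) n, integral_zero] at h2
  rw [← hP] at h2
  have hreal : P.real {z | z n ∈ Set.diagonal Ω ∧ z (n + 1) ∉ Set.diagonal Ω} = 0 := by
    rw [← integral_indicator_one hS]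
    simp_rw [hind]
    exact h2
  exact (measureReal_eq_zero_iff (measure_ne_top _ _)).1 hreal

/-- **ALMOST SURELY, MERGED RUNS DO NOT SPLIT**: `P̂`-a.e. pair path satisfies `Z_n ∈ Δ ⇒ Z_{n+1} ∈ Δ` for every `n`. [ours] -/
theorem crn_chain_ae_noSplit [MeasurableEq Ω] (hw : Measurable w) (hw0 : ∀ y, 0 < w y)
    (Khat : Kernel (Ω × Ω) (Ω × Ω)) [IsMarkovKernel Khat]
    (hK : ∀ z : Ω × Ω, Khat z = (q.prod (volume : Measure unitInterval)).map (fun p : Ω × unitInterval =>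
      ((if (p.2 : ℝ) * w z.1 ≤ w p.1 then p.1 else z.1), (if (p.2 : ℝ) * w z.2 ≤ w p.1 then p.1 else z.2))))
    (μ₀ : Measure (Ω × Ω)) [IsProbabilityMeasure μ₀] :
    ∀ᵐ z ∂(Kernel.trajMeasure (X := fun _ : ℕ => Ω × Ω) μ₀
        (fun n : ℕ => Khat.comap (fun h : (i : ↥(Finset.Iic n)) → Ω × Ω => h ⟨n, Finset.mem_Iic.2 le_rfl⟩)
          (measurable_pi_apply _))),
      ∀ n, z n ∈ Set.diagonal Ω → z (n + 1) ∈ Set.diagonal Ω := by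
  rw [ae_all_iff]
  intro n
  have h0 := crn_chain_diag_succ_offDiagonal_eq_zero hw hw0 Khat hK μ₀ n
  rw [measure_eq_zero_iff_ae_notMem] at h0
  filter_upwards [h0] with z hz
  intro hzn
  by_contra hc
  exact hz ⟨hzn, hc⟩

/-- **ALMOST SURELY, RUNS THAT HAVE MET STAY TOGETHER**: `P̂`-a.e. pair path satisfies `Z_n ∈ Δ ⇒ Z_m ∈ Δ` for all `n ≤ m`. [ours] -/
theorem crn_chain_ae_merged_stay [MeasurableEq Ω] (hw : Measurable w) (hw0 : ∀ y, 0 < w y)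
    (Khat : Kernel (Ω × Ω) (Ω × Ω)) [IsMarkovKernel Khat]
    (hK : ∀ z : Ω × Ω, Khat z = (q.prod (volume : Measure unitInterval)).map (fun p : Ω × unitInterval =>
      ((if (p.2 : ℝ) * w z.1 ≤ w p.1 then p.1 else z.1), (if (p.2 : ℝ) * w z.2 ≤ w p.1 then p.1 else z.2))))
    (μ₀ : Measure (Ω × Ω)) [IsProbabilityMeasure μ₀] :
    ∀ᵐ z ∂(Kernel.trajMeasure (X := fun _ : ℕ => Ω × Ω) μ₀
        (fun n : ℕ => Khat.comap (fun h : (i : ↥(Finset.Iic n)) → Ω × Ω => h ⟨n, Finset.mem_Iic.2 le_rfl⟩)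
          (measurable_pi_apply _))),
      ∀ n m, n ≤ m → z n ∈ Set.diagonal Ω → z m ∈ Set.diagonal Ω := by
  filter_upwards [crn_chain_ae_noSplit hw hw0 Khat hK μ₀] with z hz
  intro n m hnm hzn
  induction m, hnm using Nat.le_induction with
  | base => exact hzn
  | succ m _ ih => exact hz m ih

/-! ## §2 After `n` shared updates the runs coincide forever, except with probability `rⁿ·P(X_0 ≠ X′_0)` -/

/-- The time-`n` disagreement probability read on the pair path law: `P̂(Z_n ∉ Δ) = (μ̂₀K̂ⁿ)(Δᶜ)`. [ours, bookkeeping] -/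
theorem crn_chain_offDiagonal_real_eq [MeasurableEq Ω] (Khat : Kernel (Ω × Ω) (Ω × Ω)) [IsMarkovKernel Khat]
    (μ₀ : Measure (Ω × Ω)) [IsProbabilityMeasure μ₀] (n : ℕ) :
    (Kernel.trajMeasure (X := fun _ : ℕ => Ω × Ω) μ₀
        (fun n : ℕ => Khat.comap (fun h : (i : ↥(Finset.Iic n)) → Ω × Ω => h ⟨n, Finset.mem_Iic.2 le_rfl⟩)
          (measurable_pi_apply _))).real {z | z n ∉ Set.diagonal Ω} =
      ((fun m : Measure (Ω × Ω) => m.bind Khat)^[n] μ₀).real (Set.diagonal Ω)ᶜ := by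
  have hD : MeasurableSet (Set.diagonal Ω) := measurableSet_diagonal
  have hIm : Measurable ((Set.diagonal Ω)ᶜ.indicator (1 : Ω × Ω → ℝ)) := measurable_one.indicator hD.compl
  have hIb : ∀ p : Ω × Ω, |(Set.diagonal Ω)ᶜ.indicator (1 : Ω × Ω → ℝ) p| ≤ 1 := by
    intro p
    by_cases hp : p ∈ (Set.diagonal Ω)ᶜ
    · rw [Set.indicator_of_mem hp, Pi.one_apply, abs_one]
    · rw [Set.indicator_of_notMem hp, abs_zero]; exact zero_le_one
  have hS : MeasurableSet {z : ℕ → Ω × Ω | z n ∉ Set.diagonal Ω} := hD.compl.preimage (measurable_pi_apply n)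
  have hind : ∀ z : ℕ → Ω × Ω, ({z : ℕ → Ω × Ω | z n ∉ Set.diagonal Ω}).indicator (1 : (ℕ → Ω × Ω) → ℝ) z =
      (Set.diagonal Ω)ᶜ.indicator (1 : Ω × Ω → ℝ) (z n) := by
    intro z
    by_cases h1 : z n ∈ Set.diagonal Ω
    · have hz : z ∉ {z : ℕ → Ω × Ω | z n ∉ Set.diagonal Ω} := fun h => h h1
      have h1' : z n ∉ (Set.diagonal Ω)ᶜ := fun h => h h1
      rw [Set.indicator_of_notMem hz, Set.indicator_of_notMem h1']
    · have hz : z ∈ {z : ℕ → Ω × Ω | z n ∉ Set.diagonal Ω} := h1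
      have h1' : z n ∈ (Set.diagonal Ω)ᶜ := h1
      rw [Set.indicator_of_mem hz, Set.indicator_of_mem h1', Pi.one_apply, Pi.one_apply]
  haveI := isProbabilityMeasure_iterate_bind (κ := Khat) μ₀ n
  rw [← integral_indicator_one hS]
  simp_rw [hind]
  rw [chain_expect_eq_integral_iterate_bind Khat μ₀ hIm hIb n, integral_indicator_one hD.compl]

/-- **THE PATH-SPACE CONTRACTION WITH THE INITIAL-DISAGREEMENT FACTOR**: from every initial coupling and for every `n`,
`P̂(∃ m ≥ n, X_m ≠ X′_m) ≤ rⁿ·P(X_0 ≠ X′_0)` (`w` normalised, maximal at `x₀`, `r = 1 − 1/w(x₀)`). [ours] -/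
theorem crn_chain_notMerged_after_le [MeasurableEq Ω] (hw : Measurable w) (hw0 : ∀ y, 0 < w y) {x₀ : Ω}
    (hmax : ∀ y, w y ≤ w x₀) [IsProbabilityMeasure (q.withDensity fun y => ENNReal.ofReal (w y))]
    (Khat : Kernel (Ω × Ω) (Ω × Ω)) [IsMarkovKernel Khat]
    (hK : ∀ z : Ω × Ω, Khat z = (q.prod (volume : Measure unitInterval)).map (fun p : Ω × unitInterval =>
      ((if (p.2 : ℝ) * w z.1 ≤ w p.1 then p.1 else z.1), (if (p.2 : ℝ) * w z.2 ≤ w p.1 then p.1 else z.2))))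
    (μ₀ : Measure (Ω × Ω)) [IsProbabilityMeasure μ₀] (n : ℕ) :
    (Kernel.trajMeasure (X := fun _ : ℕ => Ω × Ω) μ₀
        (fun n : ℕ => Khat.comap (fun h : (i : ↥(Finset.Iic n)) → Ω × Ω => h ⟨n, Finset.mem_Iic.2 le_rfl⟩)
          (measurable_pi_apply _))).real {z | ∃ m, n ≤ m ∧ z m ∉ Set.diagonal Ω} ≤
      (1 - (w x₀)⁻¹) ^ n * μ₀.real (Set.diagonal Ω)ᶜ := by
  set P := Kernel.trajMeasure (X := fun _ : ℕ => Ω × Ω) μ₀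
      (fun n : ℕ => Khat.comap (fun h : (i : ↥(Finset.Iic n)) → Ω × Ω => h ⟨n, Finset.mem_Iic.2 le_rfl⟩)
        (measurable_pi_apply _)) with hP
  -- modulo a null set, «not merged at some `m ≥ n`» is «not merged at `n`»
  have hsub : P {z | ∃ m, n ≤ m ∧ z m ∉ Set.diagonal Ω} ≤ P {z | z n ∉ Set.diagonal Ω} := by
    refine measure_mono_ae ?_
    filter_upwards [crn_chain_ae_merged_stay hw hw0 Khat hK μ₀] with z hz
    rintro ⟨m, hnm, hzm⟩ hzn
    exact hzm (hz n m hnm hzn)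
  calc P.real {z | ∃ m, n ≤ m ∧ z m ∉ Set.diagonal Ω} ≤ P.real {z | z n ∉ Set.diagonal Ω} := by
        simp only [measureReal_def]; exact ENNReal.toReal_mono (measure_ne_top _ _) hsub
    _ = ((fun m : Measure (Ω × Ω) => m.bind Khat)^[n] μ₀).real (Set.diagonal Ω)ᶜ := by
        rw [hP]; exact crn_chain_offDiagonal_real_eq Khat μ₀ n
    _ ≤ (1 - (w x₀)⁻¹) ^ n * μ₀.real (Set.diagonal Ω)ᶜ := iterate_bind_crnPair_offDiagonal_le hw hw0 hmax Khat hK n μ₀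

/-- **THE TWO RUNS COINCIDE FOREVER AFTER `n` UPDATES, EXCEPT WITH PROBABILITY `rⁿ·P(X_0 ≠ X′_0)`**:
`P̂(∀ m ≥ n, X_m = X′_m) ≥ 1 − rⁿ·P(X_0 ≠ X′_0)` from every initial coupling. [ours] -/
theorem crn_chain_merged_forever_ge [MeasurableEq Ω] (hw : Measurable w) (hw0 : ∀ y, 0 < w y) {x₀ : Ω}
    (hmax : ∀ y, w y ≤ w x₀) [IsProbabilityMeasure (q.withDensity fun y => ENNReal.ofReal (w y))]
    (Khat : Kernel (Ω × Ω) (Ω × Ω)) [IsMarkovKernel Khat]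
    (hK : ∀ z : Ω × Ω, Khat z = (q.prod (volume : Measure unitInterval)).map (fun p : Ω × unitInterval =>
      ((if (p.2 : ℝ) * w z.1 ≤ w p.1 then p.1 else z.1), (if (p.2 : ℝ) * w z.2 ≤ w p.1 then p.1 else z.2))))
    (μ₀ : Measure (Ω × Ω)) [IsProbabilityMeasure μ₀] (n : ℕ) :
    1 - (1 - (w x₀)⁻¹) ^ n * μ₀.real (Set.diagonal Ω)ᶜ ≤
      (Kernel.trajMeasure (X := fun _ : ℕ => Ω × Ω) μ₀
        (fun n : ℕ => Khat.comap (fun h : (i : ↥(Finset.Iic n)) → Ω × Ω => h ⟨n, Finset.mem_Iic.2 le_rfl⟩)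
          (measurable_pi_apply _))).real {z | ∀ m, n ≤ m → (z m).1 = (z m).2} := by
  set P := Kernel.trajMeasure (X := fun _ : ℕ => Ω × Ω) μ₀
      (fun n : ℕ => Khat.comap (fun h : (i : ↥(Finset.Iic n)) → Ω × Ω => h ⟨n, Finset.mem_Iic.2 le_rfl⟩)
        (measurable_pi_apply _)) with hP
  have hD : MeasurableSet (Set.diagonal Ω) := measurableSet_diagonal
  have hE : MeasurableSet {z : ℕ → Ω × Ω | ∃ m, n ≤ m ∧ z m ∉ Set.diagonal Ω} := by
    have : {z : ℕ → Ω × Ω | ∃ m, n ≤ m ∧ z m ∉ Set.diagonal Ω} = ⋃ m, ⋃ (_ : n ≤ m), {z | z m ∉ Set.diagonal Ω} := by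
      ext z; simp
    rw [this]
    exact MeasurableSet.iUnion fun m => MeasurableSet.iUnion fun _ => hD.compl.preimage (measurable_pi_apply m)
  have hcompl : {z : ℕ → Ω × Ω | ∀ m, n ≤ m → (z m).1 = (z m).2} = {z | ∃ m, n ≤ m ∧ z m ∉ Set.diagonal Ω}ᶜ := by
    ext z
    simp only [Set.mem_setOf_eq, Set.mem_compl_iff, not_exists, not_and, not_not, Set.mem_diagonal_iff]
  have h := crn_chain_notMerged_after_le hw hw0 hmax Khat hK μ₀ n
  rw [← hP] at h
  rw [hcompl, measureReal_compl hE, probReal_univ]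
  linarith

/-! ## §3 Almost surely the two runs coincide forever from some time on -/

/-- **THE MEETING TIME IS ALMOST SURELY FINITE AND THE RUNS THEN COINCIDE FOREVER**: from every initial coupling,
`P̂`-almost every pair path satisfies `∃ n, ∀ m ≥ n, X_m = X′_m` (`w` normalised, maximal at `x₀`). [ours] -/
theorem crn_chain_ae_eventually_merged [MeasurableEq Ω] (hw : Measurable w) (hw0 : ∀ y, 0 < w y) {x₀ : Ω}
    (hmax : ∀ y, w y ≤ w x₀) [IsProbabilityMeasure (q.withDensity fun y => ENNReal.ofReal (w y))]
    (Khat : Kernel (Ω × Ω) (Ω × Ω)) [IsMarkovKernel Khat]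
    (hK : ∀ z : Ω × Ω, Khat z = (q.prod (volume : Measure unitInterval)).map (fun p : Ω × unitInterval =>
      ((if (p.2 : ℝ) * w z.1 ≤ w p.1 then p.1 else z.1), (if (p.2 : ℝ) * w z.2 ≤ w p.1 then p.1 else z.2))))
    (μ₀ : Measure (Ω × Ω)) [IsProbabilityMeasure μ₀] :
    ∀ᵐ z ∂(Kernel.trajMeasure (X := fun _ : ℕ => Ω × Ω) μ₀
        (fun n : ℕ => Khat.comap (fun h : (i : ↥(Finset.Iic n)) → Ω × Ω => h ⟨n, Finset.mem_Iic.2 le_rfl⟩)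
          (measurable_pi_apply _))),
      ∃ n, ∀ m, n ≤ m → (z m).1 = (z m).2 := by
  set P := Kernel.trajMeasure (X := fun _ : ℕ => Ω × Ω) μ₀
      (fun n : ℕ => Khat.comap (fun h : (i : ↥(Finset.Iic n)) → Ω × Ω => h ⟨n, Finset.mem_Iic.2 le_rfl⟩)
        (measurable_pi_apply _)) with hP
  have hW : 1 ≤ w x₀ := one_le_of_mode (q := q) hmax
  have hWpos : 0 < w x₀ := hw0 x₀
  have hr0 : 0 ≤ 1 - (w x₀)⁻¹ := sub_nonneg.2 (inv_le_one_of_one_le₀ hW)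
  have hr1 : 1 - (w x₀)⁻¹ < 1 := sub_lt_self _ (inv_pos.2 hWpos)
  -- the exceptional event «never merged for good» has probability `≤ rⁿ` for every `n`, hence zero
  set B : Set (ℕ → Ω × Ω) := {z | ∀ n, ∃ m, n ≤ m ∧ z m ∉ Set.diagonal Ω} with hB
  have hBle : ∀ n, P.real B ≤ (1 - (w x₀)⁻¹) ^ n := by
    intro n
    have h1 : P B ≤ P {z | ∃ m, n ≤ m ∧ z m ∉ Set.diagonal Ω} := measure_mono fun z hz => hz n
    have h2 := crn_chain_notMerged_after_le hw hw0 hmax Khat hK μ₀ n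
    rw [← hP] at h2
    calc P.real B ≤ P.real {z | ∃ m, n ≤ m ∧ z m ∉ Set.diagonal Ω} := by
          simp only [measureReal_def]; exact ENNReal.toReal_mono (measure_ne_top _ _) h1
      _ ≤ (1 - (w x₀)⁻¹) ^ n * μ₀.real (Set.diagonal Ω)ᶜ := h2
      _ ≤ (1 - (w x₀)⁻¹) ^ n * 1 := mul_le_mul_of_nonneg_left measureReal_le_one (pow_nonneg hr0 n)
      _ = (1 - (w x₀)⁻¹) ^ n := mul_one _
  have htend : Tendsto (fun n : ℕ => (1 - (w x₀)⁻¹) ^ n) atTop (𝓝 0) := tendsto_pow_atTop_nhds_zero_of_lt_one hr0 hr1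
  have hB0 : P.real B ≤ 0 := ge_of_tendsto' htend hBle
  have hB0' : P B = 0 := (measureReal_eq_zero_iff (measure_ne_top _ _)).1 (le_antisymm hB0 measureReal_nonneg)
  rw [measure_eq_zero_iff_ae_notMem] at hB0'
  filter_upwards [hB0'] with z hz
  by_contra hcon
  apply hz
  intro n
  by_contra hn
  apply hcon
  refine ⟨n, fun m hnm => ?_⟩
  by_contra hm
  exact hn ⟨m, hnm, fun hd => hm (Set.mem_diagonal_iff.1 hd)⟩

end Summit.Ventures.LatticeQCDFlow.Exactness

end
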